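import Mathlib
import Summits.NavierStokesRegularity.NavierStokesRegularity.Theorems.SubOnsagerCeilingDyadicRangeRegion
import HarnessLib

/-!
# The re-tuned Barbato–Morandin–Romito region WITHOUT geometric rates: per-bond rate ratios `F_{n+1}/Fₙ ≥ p²`
# (helper file for crux stmt-NavierStokesRegularity-27057 `SubOnsagerCeiling.ForwardTailCeilingKP`, `--supports`;
# variant of ns-soc-p2 g3's `DyadicRange.invariantRegion_le_one_of_tail`)

`DyadicRange.invariantRegion_le_one_of_tail` (sibling file) is the first-exit argument on BMR's re-tuned region
`{0 ≤ x ≤ 1, h(x) ≤ y ≤ min(x/2 + 3/5, 1)}` for an infinite chain `Ẏₙ = -κₙYₙ + Fₙ(Y²ₙ₋₁ − pYₙYₙ₊₁)` with a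
quiescent tail; its rate law is GEOMETRIC, `F_{n+1} = L·Fₙ` with one ratio `L ≥ p²`.  Inspection of the proof
shows that the rate law enters only through the two inward-pointing inequalities `top_slant_deriv_neg` /
`bottom_curve_deriv_neg`, each of which involves ONE bond and needs only `F_{n+1}/Fₙ ≥ p²` for THAT bond.  This
file records the resulting variant:

* `invariantRegion_le_one_of_tail_var` — the same conclusion `Yₙ ≤ 1` under `p²·Fₙ ≤ F_{n+1}` for every `n`
  (no common ratio), everything else verbatim (`0 < κₙ ≤ κₙ₊₁ ≤ 4κₙ`, `42/25 ≤ p`, `pc = 1`, data `≤ 1/10`,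
  quiescent tail).

WHY (toward the registered stubs `stub_primaryGradedLargeRatio` / `…SmallRatio` of the LEAD skeleton
`Cruxes/ForwardTailCeilingKP/Lines/kp_shell_barrier.lean`): the uncovered RECURRENT architectures next in line are
chains with NON-GEOMETRIC rates — the ASYMMETRIC re-entry pair `kpTwoCycleTable c₀ c₁`, `c₀ ≠ c₁` (strands = chains
with weights alternating `c₀, c₁`) and feed–pump ladders (stuttering rates).  For a strand
`Żₖ = c_{k-1}Λ_{k-1}Z²_{k-1} − cₖΛₖZₖZ_{k+1} − νb^{2k}Zₖ` (`Λₖ = b^{5k/2}`) the rescaling `Y_{k+1} = A b^{θk} sₖ Zₖ` with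
`s_{k+1} = (cₖ/c_{k-1}) s²_{k-1}/sₖ` keeps the drain coefficient `p = b^{5/2−3θ}` CONSTANT and puts all the
asymmetry into the bond ratios `F_{k+2}/F_{k+1} = (cₖ/c_{k-1})²(s_{k-1}/sₖ)⁴ b^{5/2−θ}`; for alternating weights
(`s = 1, r, 1, r, …`, `r = c₁/c₀`) these are `r^{±2} b^{5/2−θ}`, so this lemma applies as soon as
`p² = b^{5−6θ} ≤ min(r², r⁻²)·b^{5/2−θ}`, i.e. `|log_b r| ≤ (5θ − 5/2)/2`, together with `p ≥ 42/25`, i.e.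
`θ ≤ (5/2 − log_b(42/25))/3` (at `b = 2`: `θ ≤ 0.584` and then `c₁/c₀ ∈ [0.864, 1.157]`; the LEAD census v9 §G
estimates the exact region's tolerance as `c₀/c₁ ∈ [0.71, 1.41]`).  The chain-level file (rescaling + unscaling, after
`DyadicRange.chain_shellBarrier`) is NOT in this file.
HONEST FRAMING: an abstract ODE lemma towards MODEL-lattice statements (route SubOnsagerCeiling, rung TL-M2Break);
nothing here bears on Navier–Stokes regularity; no stub, crux or summit is proved.
[cite: BarbatoMorandinRomito2011, §2 Lemma 2.1 and its proof]
-/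

noncomputable section

-- the sub-problem namespace `NavierStokesRegularity.NavierStokesRegularity` is the tree's layout (D-0017)
set_option linter.dupNamespace false

namespace Summit.NavierStokesRegularity.NavierStokesRegularity.Theorems.DyadicRange

open Set Filter Topology
open Literature.Barriers.NavierStokesRegularity.Dyadic

/-- **Re-tuned BMR region on an infinite chain with a quiescent tail, PER-BOND rate ratios.**  `Y₀ ≡ 0`,
`Ẏₙ = -κₙYₙ + Fₙ(Y²_{n-1} - pYₙY_{n+1})` on `[0, s)` for `n ≥ 1`, `0 < κₙ ≤ κ_{n+1} ≤ 4κₙ`, `0 < Fₙ`,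
`p²·Fₙ ≤ F_{n+1}` (no common ratio), `42/25 ≤ p`, `pc = 1`, all modes continuous and non-negative on `[0, s]`,
`Yₙ(0) ≤ 1/10` for all `n`, and `Yₙ ≤ 1/10` on `[0, s]` for `n ≥ K`. Then `Yₙ(t) ≤ 1` for all `n` and
`t ∈ [0, s]`.  Proof: ns-soc-p2's first-exit argument verbatim, the bond ratio `Lₙ = F_{n+1}/Fₙ` fed to
`top_slant_deriv_neg` / `bottom_curve_deriv_neg` bond by bond. [cite: BarbatoMorandinRomito2011, §2 Lemma 2.1] -/
theorem invariantRegion_le_one_of_tail_var {Y : ℕ → ℝ → ℝ} {κ F : ℕ → ℝ} {p c s : ℝ} {K : ℕ}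
    (hs : 0 < s)
    (hκ : ∀ n, 0 < κ n) (hκmono : ∀ n, κ n ≤ κ (n + 1)) (hκ4 : ∀ n, κ (n + 1) ≤ 4 * κ n)
    (hF : ∀ n, 0 < F n) (hFp : ∀ n, p ^ 2 * F n ≤ F (n + 1))
    (hp : 42 / 25 ≤ p) (hpc : p * c = 1)
    (hY0 : ∀ t, Y 0 t = 0)
    (hcont : ∀ n, ContinuousOn (Y n) (Icc 0 s))
    (hderiv : ∀ n, 1 ≤ n → ∀ t ∈ Ico 0 s,
      HasDerivWithinAt (Y n) (-κ n * Y n t + F n * (Y (n - 1) t ^ 2 - p * Y n t * Y (n + 1) t))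
        (Ici t) t)
    (hpos : ∀ n, ∀ t ∈ Icc 0 s, 0 ≤ Y n t)
    (hinit : ∀ n, Y n 0 ≤ 1 / 10)
    (htail : ∀ n, K ≤ n → ∀ t ∈ Icc 0 s, Y n t ≤ 1 / 10) :
    ∀ n, ∀ t ∈ Icc 0 s, Y n t ≤ 1 := by
  have hp0 : 0 < p := by linarith
  have hc0 : 0 < c := by
    have : 0 < p * c := by rw [hpc]; exact one_pos
    exact pos_of_mul_pos_right this hp0.le
  have hc1 : c ≤ 25 / 42 := by
    have : 42 / 25 * c ≤ p * c := mul_le_mul_of_nonneg_right hp hc0.le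
    rw [hpc] at this
    linarith
  -- per-bond rate ratios `Lₙ = F_{n+1}/Fₙ ≥ p²` (the only use of the rate law)
  have hLn : ∀ n, F (n + 1) = (F (n + 1) / F n) * F n ∧ p ^ 2 ≤ F (n + 1) / F n := fun n =>
    ⟨by field_simp [(hF n).ne'], by rw [le_div_iff₀ (hF n)]; exact hFp n⟩
  -- the lower curve
  set h : ℝ → ℝ := fun x => if x ≤ 1 / 10 then (0 : ℝ) else c * ((x - 1 / 10) / (9 / 10)) ^ 4
    with hh
  -- the constraint predicate (only the first `K` pairs can be active)
  set P : ℝ → Prop := fun t =>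
    (∀ n ∈ Finset.Icc 1 K, Y n t ≤ 1) ∧
      (∀ n ∈ Finset.Icc 1 K, Y (n + 1) t ≤ 1 / 2 * Y n t + 3 / 5) ∧
      (∀ n ∈ Finset.Icc 1 K, h (Y n t) ≤ Y (n + 1) t) with hP
  suffices key : ∀ t ∈ Icc 0 s, P t by
    intro n t ht
    rcases Nat.eq_zero_or_pos n with rfl | hn1
    · rw [hY0]; norm_num
    rcases le_or_gt K n with hKn | hnK
    · linarith [htail n hKn t ht]
    · have := key t ht
      simp only [hP] at this
      exact this.1 n (Finset.mem_Icc.2 ⟨hn1, hnK.le⟩)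
  -- `P 0`
  have hP0 : P 0 := by
    simp only [hP]
    refine ⟨fun n _ => ?_, fun n _ => ?_, fun n _ => ?_⟩
    · linarith [hinit n]
    · have h1 := hinit (n + 1)
      have h2 := hpos n 0 ⟨le_rfl, hs.le⟩
      linarith
    · have h1 := hinit n
      rw [hh]; dsimp only; rw [if_pos h1]
      exact hpos (n + 1) 0 ⟨le_rfl, hs.le⟩
  -- the constraints are closed
  have hclosed : ∀ t ∈ Ioc 0 s, (∀ r ∈ Ico 0 t, P r) → P t := by
    intro t ht hPs
    simp only [hP] at hPs ⊢
    refine ⟨fun n hn => ?_, fun n hn => ?_, fun n hn => ?_⟩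
    · exact le_of_forall_Ico_le (hcont n) continuousOn_const ht fun r hr => (hPs r hr).1 n hn
    · exact le_of_forall_Ico_le (hcont (n + 1))
        ((continuousOn_const.mul (hcont n)).add continuousOn_const) ht
        fun r hr => (hPs r hr).2.1 n hn
    · exact le_of_forall_Ico_le ((continuous_lowerCurve c).comp_continuousOn (hcont n))
        (hcont (n + 1)) ht fun r hr => (hPs r hr).2.2 n hn
  -- the maximal time
  set T := Literature.Analysis.ODE.maximalTimeP P 0 s with hT
  have hTmem : T ∈ Icc 0 s := Literature.Analysis.ODE.maximalTimeP_mem hs.le hP0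
  have hPT : ∀ t ∈ Icc 0 T, P t := fun t ht =>
    Literature.Analysis.ODE.maximalTimeP_spec hs.le hP0 hclosed ht
  by_contra hall
  have hTb : T < s := by
    rcases lt_or_eq_of_le hTmem.2 with hlt | heq
    · exact hlt
    · exact absurd (fun t ht => hPT t (heq ▸ ht)) hall
  have hT0 : 0 ≤ T := hTmem.1
  have hTs : T ∈ Icc 0 s := ⟨hT0, hTb.le⟩
  -- the state at time `T`
  have hPτ := hPT T ⟨hT0, le_rfl⟩
  simp only [hP] at hPτ
  obtain ⟨hR, hTop, hBot⟩ := hPτ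
  have hposT : ∀ k, 0 ≤ Y k T := fun k => hpos k T hTs
  have htailT : ∀ k, K ≤ k → Y k T ≤ 1 / 10 := fun k hk => htail k hk T hTs
  have hle1 : ∀ k, Y k T ≤ 1 := by
    intro k
    rcases Nat.eq_zero_or_pos k with rfl | hk1
    · rw [hY0]; norm_num
    rcases le_or_gt K k with hKk | hkK
    · linarith [htailT k hKk]
    · exact hR k (Finset.mem_Icc.2 ⟨hk1, hkK.le⟩)
  -- the upper neighbour is at least `h` of the mode
  have hlow : ∀ k, 1 ≤ k → 1 / 10 ≤ Y k T →
      c * ((Y k T - 1 / 10) / (9 / 10)) ^ 4 ≤ Y (k + 1) T := by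
    intro k hk1 hkδ
    rcases le_or_gt k K with hkK | hKk
    · have := hBot k (Finset.mem_Icc.2 ⟨hk1, hkK⟩)
      rw [hh] at this; dsimp only at this
      rcases eq_or_lt_of_le hkδ with heq | hgt
      · rw [← heq]; norm_num; exact hposT (k + 1)
      · rwa [if_neg (not_le.2 hgt)] at this
    · have heq : Y k T = 1 / 10 := le_antisymm (htailT k hKk.le) hkδ
      rw [heq]; norm_num; exact hposT (k + 1)
  -- the upper neighbour is at most `Y/2 + 3/5`
  have hupp : ∀ k, 1 ≤ k → Y (k + 1) T ≤ 1 / 2 * Y k T + 3 / 5 := by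
    intro k hk1
    rcases le_or_gt k K with hkK | hKk
    · exact hTop k (Finset.mem_Icc.2 ⟨hk1, hkK⟩)
    · have h1 := htailT (k + 1) (by omega)
      have h2 := hposT k
      linarith
  -- continuity within `[T, ∞)` at `T` (from continuity on `[0, s]`, `T < s`)
  have hnhds : Icc 0 s ∈ 𝓝[Ici T] T := Icc_mem_nhdsGE_of_mem ⟨hT0, hTb⟩
  have hcw : ∀ k, ContinuousWithinAt (Y k) (Ici T) T := fun k =>
    ((hcont k) T hTs).mono_of_mem_nhdsWithin hnhds
  -- derivatives at `T`
  have hd : ∀ k, 1 ≤ k → HasDerivWithinAt (Y k)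
      (-κ k * Y k T + F k * (Y (k - 1) T ^ 2 - p * Y k T * Y (k + 1) T)) (Ici T) T :=
    fun k hk1 => hderiv k hk1 T ⟨hT0, hTb⟩
  ------------------------------------------------------------------
  -- (R) the constraints `Yₙ ≤ 1` persist
  ------------------------------------------------------------------
  have evR : ∀ n ∈ Finset.Icc 1 K, ∀ᶠ t in 𝓝[Ici T] T, Y n t ≤ 1 := by
    intro n hn
    obtain ⟨hn1, hnK⟩ := Finset.mem_Icc.1 hn
    rcases lt_or_eq_of_le (hle1 n) with hlt | heq
    · exact ((hcw n).eventually_lt_const hlt).mono fun t ht => ht.le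
    · have hφ := (hd n hn1).sub_const 1
      have hz : c ≤ Y (n + 1) T := by
        have := hlow n hn1 (by rw [heq]; norm_num)
        rw [heq] at this
        norm_num at this
        exact this
      have hneg : -κ n * Y n T + F n * (Y (n - 1) T ^ 2 - p * Y n T * Y (n + 1) T) < 0 := by
        rw [heq]
        exact rhs_neg_at_one (hκ n) (hF n).le hp0.le hpc (hposT (n - 1)) (hle1 (n - 1)) hz
      exact (eventually_nonpos_of_hasDerivWithinAt_neg hφ hneg (by simp [heq])).mono
        fun t ht => by linarith
  ------------------------------------------------------------------
  -- (T) the constraints `Y_{n+1} ≤ Yₙ/2 + 3/5` persist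
  ------------------------------------------------------------------
  have evT : ∀ n ∈ Finset.Icc 1 K, ∀ᶠ t in 𝓝[Ici T] T,
      Y (n + 1) t ≤ 1 / 2 * Y n t + 3 / 5 := by
    intro n hn
    obtain ⟨hn1, hnK⟩ := Finset.mem_Icc.1 hn
    rcases lt_or_eq_of_le (hupp n hn1) with hlt | heq
    · have hc2 : ContinuousWithinAt (fun t => Y (n + 1) t - (1 / 2 * Y n t + 3 / 5)) (Ici T) T :=
        (hcw (n + 1)).sub ((continuousWithinAt_const.mul (hcw n)).add continuousWithinAt_const)
      have hlt' : Y (n + 1) T - (1 / 2 * Y n T + 3 / 5) < 0 := by linarith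
      exact (hc2.eventually_lt_const hlt').mono
        fun t (ht : Y (n + 1) t - (1 / 2 * Y n t + 3 / 5) < 0) => by linarith
    · -- active constraint: the derivative is strictly negative (piece `n₂`)
      have hdn := hd n hn1
      have hdn1 := hd (n + 1) (by omega)
      simp only [Nat.add_sub_cancel] at hdn1
      have hφ := hdn1.sub ((hdn.const_mul (1 / 2 : ℝ)).add_const (3 / 5 : ℝ))
      have hy1 : Y (n + 1) T ≤ 1 := hle1 (n + 1)
      have hyδ : 1 / 10 ≤ Y (n + 1) T := by rw [heq]; linarith [hposT n]
      have hz := hlow (n + 1) (by omega) hyδ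
      have hneg : (-κ (n + 1) * Y (n + 1) T +
            F (n + 1) * (Y n T ^ 2 - p * Y (n + 1) T * Y (n + 1 + 1) T)) -
          1 / 2 * (-κ n * Y n T + F n * (Y (n - 1) T ^ 2 - p * Y n T * Y (n + 1) T)) < 0 := by
        obtain ⟨hFL, hpL⟩ := hLn n
        rw [hFL]
        have := top_slant_deriv_neg (hκ n) (hκmono n) (hF n) hp hpL hpc (hposT n)
          heq hy1 hz (w := Y (n - 1) T)
        convert this using 2
      have h0 : Y (n + 1) T - (1 / 2 * Y n T + 3 / 5) ≤ 0 := by linarith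
      exact (eventually_nonpos_of_hasDerivWithinAt_neg hφ hneg h0).mono
        fun t (ht : Y (n + 1) t - (1 / 2 * Y n t + 3 / 5) ≤ 0) => by linarith
  ------------------------------------------------------------------
  -- (B) the constraints `h(Yₙ) ≤ Y_{n+1}` persist
  ------------------------------------------------------------------
  have evB : ∀ n ∈ Finset.Icc 1 K, ∀ᶠ t in 𝓝[Ici T] T, h (Y n t) ≤ Y (n + 1) t := by
    intro n hn
    obtain ⟨hn1, hnK⟩ := Finset.mem_Icc.1 hn
    by_cases hxδ : Y n T < 1 / 10
    · -- flat bottom piece: `h ≡ 0` and positivity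
      have ev1 : ∀ᶠ t in 𝓝[Ici T] T, Y n t < 1 / 10 := (hcw n).eventually_lt_const hxδ
      have ev2 : ∀ᶠ t in 𝓝[Ici T] T, t ∈ Icc 0 s := by
        filter_upwards [hnhds] with t ht using ht
      filter_upwards [ev1, ev2] with t ht hts
      rw [hh]; dsimp only; rw [if_pos ht.le]
      exact hpos (n + 1) t hts
    · push Not at hxδ
      rcases lt_or_eq_of_le (show h (Y n T) ≤ Y (n + 1) T from
          hBot n (Finset.mem_Icc.2 ⟨hn1, hnK⟩)) with hlt | heq
      · have hc2 : ContinuousWithinAt (fun t => h (Y n t) - Y (n + 1) t) (Ici T) T :=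
          (((continuous_lowerCurve c).continuousAt).comp_continuousWithinAt (hcw n)).sub (hcw (n + 1))
        have hlt' : h (Y n T) - Y (n + 1) T < 0 := by linarith
        exact (hc2.eventually_lt_const hlt').mono fun t ht => by linarith
      · -- active constraint on the curved bottom piece
        have hdn := hd n hn1
        have hdn1 := hd (n + 1) (by omega)
        simp only [Nat.add_sub_cancel] at hdn1
        have hchain := (hasDerivAt_lowerCurve c (Y n T)).comp_hasDerivWithinAt T hdn
        have hφ := hchain.sub hdn1
        have h0 : h (Y n T) - Y (n + 1) T ≤ 0 := by rw [heq]; simp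
        rcases eq_or_lt_of_le hxδ with hxeq | hxgt
        · -- the corner `x = δ`: `h = h' = 0`, `Y_{n+1} = 0`
          have hy0 : Y (n + 1) T = 0 := by
            rw [← heq, hh]; dsimp only; rw [if_pos hxeq.symm.le]
          have hneg : (if Y n T ≤ 1 / 10 then (0 : ℝ)
                else 4 * c * ((Y n T - 1 / 10) / (9 / 10)) ^ 3 / (9 / 10)) *
                (-κ n * Y n T + F n * (Y (n - 1) T ^ 2 - p * Y n T * Y (n + 1) T)) -
              (-κ (n + 1) * Y (n + 1) T +
                F (n + 1) * (Y n T ^ 2 - p * Y (n + 1) T * Y (n + 1 + 1) T)) < 0 := by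
            rw [if_pos hxeq.symm.le, hy0, ← hxeq]
            exact bottom_corner_deriv_neg (hF (n + 1))
          exact (eventually_nonpos_of_hasDerivWithinAt_neg hφ hneg h0).mono fun t ht => by
            simpa [Function.comp, hh] using ht
        · -- `x > δ`: piece `n₅`
          have hy : Y (n + 1) T = c * ((Y n T - 1 / 10) / (9 / 10)) ^ 4 := by
            rw [← heq, hh]; dsimp only; rw [if_neg (not_le.2 hxgt)]
          have hx1 : Y n T ≤ 1 := hle1 n
          have hzupp := hupp (n + 1) (by omega)
          have hneg : (if Y n T ≤ 1 / 10 then (0 : ℝ)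
                else 4 * c * ((Y n T - 1 / 10) / (9 / 10)) ^ 3 / (9 / 10)) *
                (-κ n * Y n T + F n * (Y (n - 1) T ^ 2 - p * Y n T * Y (n + 1) T)) -
              (-κ (n + 1) * Y (n + 1) T +
                F (n + 1) * (Y n T ^ 2 - p * Y (n + 1) T * Y (n + 1 + 1) T)) < 0 := by
            obtain ⟨hFL, hpL⟩ := hLn n
            rw [if_neg (not_le.2 hxgt), hFL]
            have := bottom_curve_deriv_neg (hκ n).le (hκ4 n) (hF n) hp hpL hpc hxgt.le hx1
              hy hzupp (hposT (n - 1)) (hle1 (n - 1))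
            convert this using 2
          exact (eventually_nonpos_of_hasDerivWithinAt_neg hφ hneg h0).mono fun t ht => by
            simpa [Function.comp, hh] using ht
  ------------------------------------------------------------------
  -- exit: `P` holds eventually at `T` within `[0, s]`, contradicting `T < s`
  ------------------------------------------------------------------
  have hright : ∀ᶠ t in 𝓝[Ici T] T, P t := by
    have e1 := (Filter.eventually_all_finset _).2 evR
    have e2 := (Filter.eventually_all_finset _).2 evT
    have e3 := (Filter.eventually_all_finset _).2 evB
    filter_upwards [e1, e2, e3] with t h1 h2 h3
    simp only [hP]
    exact ⟨h1, h2, h3⟩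
  exact Literature.Analysis.ODE.not_eventually_of_maximalTimeP_lt hs.le hP0 hTb
    (eventually_nhdsWithin_Icc_of_left_of_right hPT hright)



end Summit.NavierStokesRegularity.NavierStokesRegularity.Theorems.DyadicRange

end
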